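import Mathlib
import HarnessLib
import Literature.Computability.AlgebraicComplexity.VBPClosedUnderComposition
import Literature.Computability.AlgebraicComplexity.IMMWeaklySkew
import Literature.Computability.AlgebraicComplexity.BLMW11FormulasWeaklySkew
import Literature.Computability.AlgebraicComplexity.FSV18SuccinctGenerators

/-!
# DefinabilityGap — ROABP ⊆ VBP quantitatively (support for `KIPlantedHitting`, item `stmt-ValiantsHypothesis-23547`)

Support lemma for route `route-ValiantsHypothesis-DefinabilityGap` (decomp-valiant lens 5, gen 2). The route's crux
`KIPlantedHitting` (K1: the KI-planted permanent map `G_m` hits p-size circuits) is being split at `VP_ws` (child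
`KIPlantedHittingWs`: `G_m` hits polynomials of p-bounded WEAKLY-SKEW complexity), with the typed ws-world rung
`KIPlantedHittingRO` (`G_m` hits read-once oblivious ABPs of p-bounded width/degree, `IsROABP`). This file supplies the
KERNEL arrow "an ROABP is an ABP", quantitatively and over any finite index type:

* `wsComplexity_polynomial_aeval_X_le` — a univariate layer entry of degree `≤ d` in `X j` has `L_ws ≤ (d+1)(d+2)`;
* `exists_eq_aeval_immMatrix_of_isROABP` — an ROABP is a substitution instance of an `IMM` entry;
* `wsComplexity_le_of_isROABP` — `IsROABP ℂ w d π f` (`N` layers, `n` variables) ⟹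
  `L_ws(f) ≤ roabpWsBound N w d n`, an explicit polynomial (via `IMMSkew.wsComplexity_immMatrix_entry_le` and
  `VBP` closed under composition, `hasInvRepr_aeval_of_wsComplexity_le` + `wsComplexity_le_of_hasInvRepr`);
* `isPBounded_roabpWsBound` — the bound is p-bounded along `(q³, q^b, q^b, q³)` (the K1ro parameters), and the tree's
  `Literature.Computability.AlgebraicComplexity.pow_add_self_le_pow_succ` (`q^c + c ≤ q^(c+1)`, GCTProofs) together turn "K1ws at exponent `c+1`" into "K1ro at
  exponent `b`" (the lens file's `k1ro_of_k1ws`).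
-/

noncomputable section

open MvPolynomial
open Literature.Computability.AlgebraicComplexity

namespace Summit.ValiantsHypothesis.ValiantsHypothesis.Theorems.DefinabilityGapROABPWs

section ROABPws

variable {ι : Type*}

open ArithCircuit in
/-- A power `X j ^ i` has a well-formed fan-in-two formula of size `≤ i`. [folklore] -/
theorem exists_formula_X_pow (j : ι) (i : ℕ) :
    ∃ P : ArithCircuit ℂ ι, P.WellFormed ∧ P.IsFormula ∧ P.IsFanInTwo ∧
      P.eval = (X j : MvPolynomial ι ℂ) ^ i ∧ P.size ≤ i := by
  have h := exists_formula_list_prod (T := List.replicate i (X j : MvPolynomial ι ℂ)) (b := 0)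
    (fun p hp => by
      obtain rfl := List.eq_of_mem_replicate hp
      exact exists_formula_X (k := ℂ) j)
  rw [List.prod_replicate, List.length_replicate] at h
  exact exists_formula_mono h (by omega)

open ArithCircuit in
/-- A term `C c * X j ^ i` has a well-formed fan-in-two formula of size `≤ i + 1`. [folklore] -/
theorem exists_formula_C_mul_X_pow (j : ι) (c : ℂ) (i : ℕ) :
    ∃ P : ArithCircuit ℂ ι, P.WellFormed ∧ P.IsFormula ∧ P.IsFanInTwo ∧
      P.eval = C c * (X j : MvPolynomial ι ℂ) ^ i ∧ P.size ≤ i + 1 := by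
  have := exists_formula_mul (exists_formula_C (σ := ι) c) (exists_formula_X_pow j i)
  exact exists_formula_mono this (by omega)

open ArithCircuit in
/-- **`L_ws` of a univariate layer entry**: a polynomial of degree `≤ d` in one variable `X j` has
`L_ws ≤ (d+1)(d+2)` (sum of `d+1` terms `c_i X_j^i`, each a formula of size `≤ d+1`; formulas are weakly skew).
[cite: BurgisserEtAl2011, §9.1 (L_e ≥ L_ws)] -/
theorem wsComplexity_polynomial_aeval_X_le (j : ι) {p : Polynomial ℂ} {d : ℕ} (hp : p.natDegree ≤ d) :
    wsComplexity (Polynomial.aeval (X j : MvPolynomial ι ℂ) p) ≤ (d + 1) * (d + 2) := by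
  have hsum : Polynomial.aeval (X j : MvPolynomial ι ℂ) p =
      ∑ i ∈ Finset.range (d + 1), C (p.coeff i) * (X j : MvPolynomial ι ℂ) ^ i := by
    rw [Polynomial.aeval_eq_sum_range' (Nat.lt_succ_of_le hp)]
    exact Finset.sum_congr rfl fun i _ => by rw [MvPolynomial.smul_eq_C_mul]
  obtain ⟨P, -, hF, h2, hev, hsz⟩ := exists_formula_finset_sum (k := ℂ) (Finset.range (d + 1))
    (f := fun i => C (p.coeff i) * (X j : MvPolynomial ι ℂ) ^ i) (b := d + 1)
    (fun i hi => exists_formula_mono (exists_formula_C_mul_X_pow j (p.coeff i) i)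
      (by have := Finset.mem_range.1 hi; omega))
  rw [hsum]
  refine (wsComplexity_le_size_of_isFormula hF h2 hev).trans (hsz.trans ?_)
  rw [Finset.card_range]

/-- **An ROABP is a substitution instance of an IMM entry** (kernel): the `(0,0)` entry of the ordered product of
the layer matrices is `IMM`'s `(0,0)` entry with the generic variable `x^{(t)}_{ab}` replaced by the layer entry
`M_t[a,b]` (a univariate polynomial in `X (π t)`). [cite: ForbesShpilkaVolk2018, §5.3] -/
theorem exists_eq_aeval_immMatrix_of_isROABP {N w d : ℕ} {π : Fin N ≃ ι} {f : MvPolynomial ι ℂ}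
    (hf : IsROABP ℂ w d π f) :
    ∃ (hw : 0 < w) (g : Fin N × Fin w × Fin w → MvPolynomial ι ℂ),
      (∀ x, ∃ p : Polynomial ℂ, p.natDegree ≤ d ∧ g x = Polynomial.aeval (X (π x.1)) p) ∧
      f = aeval g (immMatrix (Fin w) N ℂ ⟨0, hw⟩ ⟨0, hw⟩) := by
  obtain ⟨hw, M, hM, rfl⟩ := hf
  set g : Fin N × Fin w × Fin w → MvPolynomial ι ℂ := fun x => M x.1 x.2.1 x.2.2 with hg
  refine ⟨hw, g, fun x => hM x.1 x.2.1 x.2.2, ?_⟩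
  have hmat : (aeval g).toRingHom.mapMatrix (immMatrix (Fin w) N ℂ) = (List.ofFn M).prod := by
    rw [immMatrix, map_list_prod, List.map_map, List.ofFn_eq_map]
    congr 1
    refine List.map_congr_left fun t _ => ?_
    ext a b
    simp [g, Matrix.mvPolynomialX_apply, rename_X]
  have := congrArg (fun A : Matrix (Fin w) (Fin w) (MvPolynomial ι ℂ) => A ⟨0, hw⟩ ⟨0, hw⟩) hmat
  simp only [RingHom.mapMatrix_apply, Matrix.map_apply] at this
  simpa using this.symm

/-- `L_ws` from an inverse read-out of size `m` in `n` variables (the bound of `wsComplexity_le_of_hasInvRepr`). [this route: DefinabilityGap, lens-5 split kit] -/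
def wsOfInvRepr (m n : ℕ) : ℕ :=
  ((m + 1 + 2) * (4 * (m + 1) ^ 3 + 7) ^ 2 + (m + 1) * (m + 1)) * (2 * n + 3)

/-- Inverse read-out size of a composition `f(g)` with `L_ws(f) ≤ r`, `L_ws(g_i) ≤ r'` (the bound of
`hasInvRepr_aeval_of_wsComplexity_le`). [this route: DefinabilityGap, lens-5 split kit] -/
def invReprOfComp (r r' : ℕ) : ℕ :=
  (12 * r + 4) * (24 * r + 4) * ((12 * r + 4) * (24 * r + 4)) *
      ((12 * r' + 4) * (24 * r' + 4) + 2 + 6) + (12 * r + 4) * (24 * r + 4) + 2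

/-- The explicit polynomial bound of `wsComplexity_le_of_isROABP` (`N` layers, width `w`, individual degree `≤ d`,
`n` variables). [this route: DefinabilityGap, lens-5 split kit] -/
def roabpWsBound (N w d n : ℕ) : ℕ :=
  wsOfInvRepr (invReprOfComp ((N + 2) * (2 * ((N + 1) * w) + 3) ^ 2) ((d + 1) * (d + 2))) n

/-- **ROABP ⊆ VBP, quantitatively (kernel)**: a polynomial with an ROABP (`N` layers, width `w`, individual degree
`≤ d`, any order) in `n` variables has `L_ws ≤ roabpWsBound N w d n`, a fixed polynomial — through "an ROABP is
`IMM(M_0, …, M_{N-1})`" (`exists_eq_aeval_immMatrix_of_isROABP`), `L_ws(IMM entry) ≤ (N+2)(2(N+1)w+3)²`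
(`IMMSkew.wsComplexity_immMatrix_entry_le`), `L_ws` of the univariate layer entries, and `VBP` closed under composition
(`hasInvRepr_aeval_of_wsComplexity_le`, `wsComplexity_le_of_hasInvRepr`).
[cite: ForbesShpilkaVolk2018, §5.3; Burgisser2024Completeness, §3.1] -/
theorem wsComplexity_le_of_isROABP [Fintype ι] [DecidableEq ι] {N w d : ℕ} {π : Fin N ≃ ι}
    {f : MvPolynomial ι ℂ} (hf : IsROABP ℂ w d π f) :
    wsComplexity f ≤ roabpWsBound N w d (Fintype.card ι) := by
  obtain ⟨hw, g, hg, rfl⟩ := exists_eq_aeval_immMatrix_of_isROABP hf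
  have hr := IMMSkew.wsComplexity_immMatrix_entry_le ℂ w N ⟨0, hw⟩ ⟨0, hw⟩
  have hg' : ∀ x, wsComplexity (g x) ≤ (d + 1) * (d + 2) := fun x => by
    obtain ⟨p, hp, hpx⟩ := hg x
    rw [hpx]
    exact wsComplexity_polynomial_aeval_X_le _ hp
  exact wsComplexity_le_of_hasInvRepr (hasInvRepr_aeval_of_wsComplexity_le hr g hg')

/-- p-boundedness of `wsOfInvRepr` along p-bounded arguments. [this route: DefinabilityGap, lens-5 split kit] -/
theorem isPBounded_wsOfInvRepr {m n : ℕ → ℕ} (hm : IsPBounded m) (hn : IsPBounded n) :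
    IsPBounded fun q => wsOfInvRepr (m q) (n q) := by
  have h1 : IsPBounded fun q => m q + 1 := IsPBounded.add_holds hm (IsPBounded.const 1)
  unfold wsOfInvRepr
  exact IsPBounded.mul_holds
    (IsPBounded.add_holds
      (IsPBounded.mul_holds (IsPBounded.add_holds h1 (IsPBounded.const 2))
        (IsPBounded.pow_holds
          (IsPBounded.add_holds (IsPBounded.mul_holds (IsPBounded.const 4) (IsPBounded.pow_holds h1 3))
            (IsPBounded.const 7)) 2))
      (IsPBounded.mul_holds h1 h1))
    (IsPBounded.add_holds (IsPBounded.mul_holds (IsPBounded.const 2) hn) (IsPBounded.const 3))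

/-- p-boundedness of `invReprOfComp` along p-bounded arguments. [this route: DefinabilityGap, lens-5 split kit] -/
theorem isPBounded_invReprOfComp {r r' : ℕ → ℕ} (hr : IsPBounded r) (hr' : IsPBounded r') :
    IsPBounded fun q => invReprOfComp (r q) (r' q) := by
  have hX : IsPBounded fun q => 12 * r q + 4 :=
    IsPBounded.add_holds (IsPBounded.mul_holds (IsPBounded.const 12) hr) (IsPBounded.const 4)
  have hY : IsPBounded fun q => 24 * r q + 4 :=
    IsPBounded.add_holds (IsPBounded.mul_holds (IsPBounded.const 24) hr) (IsPBounded.const 4)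
  have hX' : IsPBounded fun q => 12 * r' q + 4 :=
    IsPBounded.add_holds (IsPBounded.mul_holds (IsPBounded.const 12) hr') (IsPBounded.const 4)
  have hY' : IsPBounded fun q => 24 * r' q + 4 :=
    IsPBounded.add_holds (IsPBounded.mul_holds (IsPBounded.const 24) hr') (IsPBounded.const 4)
  have hXY : IsPBounded fun q => (12 * r q + 4) * (24 * r q + 4) := IsPBounded.mul_holds hX hY
  unfold invReprOfComp
  exact IsPBounded.add_holds
    (IsPBounded.add_holds
      (IsPBounded.mul_holds (IsPBounded.mul_holds hXY hXY)
        (IsPBounded.add_holds (IsPBounded.add_holds (IsPBounded.mul_holds hX' hY') (IsPBounded.const 2))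
          (IsPBounded.const 6)))
      hXY)
    (IsPBounded.const 2)

/-- The ROABP→`L_ws` bound is p-bounded along the K1ro parameters (`N = n = q³` cells/variables, width and degree
`q^b`). [this route: DefinabilityGap, lens-5 split kit] -/
theorem isPBounded_roabpWsBound (b : ℕ) :
    IsPBounded fun q => roabpWsBound (q ^ 3) (q ^ b) (q ^ b) (q ^ 3) := by
  have hq3 : IsPBounded fun q : ℕ => q ^ 3 := IsPBounded.pow_holds IsPBounded.id 3
  have hqb : IsPBounded fun q : ℕ => q ^ b := IsPBounded.pow_holds IsPBounded.id b
  have hr : IsPBounded fun q : ℕ => (q ^ 3 + 2) * (2 * ((q ^ 3 + 1) * q ^ b) + 3) ^ 2 :=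
    IsPBounded.mul_holds (IsPBounded.add_holds hq3 (IsPBounded.const 2))
      (IsPBounded.pow_holds
        (IsPBounded.add_holds
          (IsPBounded.mul_holds (IsPBounded.const 2)
            (IsPBounded.mul_holds (IsPBounded.add_holds hq3 (IsPBounded.const 1)) hqb))
          (IsPBounded.const 3)) 2)
  have hr' : IsPBounded fun q : ℕ => (q ^ b + 1) * (q ^ b + 2) :=
    IsPBounded.mul_holds (IsPBounded.add_holds hqb (IsPBounded.const 1))
      (IsPBounded.add_holds hqb (IsPBounded.const 2))
  unfold roabpWsBound
  exact isPBounded_wsOfInvRepr (isPBounded_invReprOfComp hr hr') hq3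

end ROABPws

end Summit.ValiantsHypothesis.ValiantsHypothesis.Theorems.DefinabilityGapROABPWs

end
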